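import Literature.AlgebraicGeometry.Resolution.ExtAnnihilatorAffineGlobal
import Literature.AlgebraicGeometry.Resolution.PrincipalizationFromMacaulayfication
import Mathlib.RingTheory.FiniteType
import HarnessLib

/-!
# Generic Cohen–Macaulayness of affine domains over a field (weak openness of the CM locus)

Topic: `Literature/AlgebraicGeometry/Resolution` (corollary of `ExtAnnihilatorAffineGlobal.lean`,
stated free of the auxiliary regular ring `B`, the resolution `F` and the model of the local ring).

* `cmClause_isLocalization_of_not_le` — `ExtAnnihilatorAffineGlobal.cmClause_localization_of_not_le`
  for ANY model `Rₚ` of the local ring at `𝔓` (`IsLocalization.AtPrime Rₚ 𝔓`, e.g. a scheme stalk).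
* `exists_ideal_ne_bot_forall_cmClause_of_surjective` — the same packaged along a presentation
  `B ↠ A` of a domain `A` by a regular affine domain `B`.
* `exists_ideal_ne_bot_forall_cmClause` — **for every affine domain `A` of finite type over a
  field there is an ideal `J ≠ 0` such that `A_𝔓` is Cohen–Macaulay (every system of parameters is
  a weakly regular sequence) for every prime `𝔓 ⊉ J`**: present `A = k[x₁,…,xₙ]/I` and take for
  `J` the image of the global `Ext`-annihilator ideal `𝔠 = ∏_{q ∈ (n-d, max n 2]} Ann E^q`. This is
  the pair of bullets "`J ≠ ⊥`", "points off `supp J` are Cohen–Macaulay" of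
  `kawasakiMacaulayfication_of_exists_isBlowup_nonCMLocus` for affine `X`, and a weak form of the
  openness of the Cohen–Macaulay locus of an excellent ring.

[cite: Kawasaki2000, La. 2.4 (1),(2); Cesnavicius2021, §2 (AR-b); BrunsHerzog1998, Thm. 8.1.1]
-/

noncomputable section

open IsLocalRing Ideal Module

universe u

namespace Literature.AlgebraicGeometry.Resolution

/-- A ring isomorphism `e` maps `R ∖ e⁻¹𝔓` onto `P ∖ 𝔓`. [folklore] -/
theorem map_primeCompl_comap_ringEquiv {R P : Type u} [CommRing R] [CommRing P] (e : R ≃+* P)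
    (𝔓 : Ideal P) [𝔓.IsPrime] :
    (𝔓.comap (e : R →+* P)).primeCompl.map (e : R →+* P).toMonoidHom = 𝔓.primeCompl := by
  ext y
  simp only [Submonoid.mem_map, Ideal.mem_primeCompl_iff, Ideal.mem_comap]
  constructor
  · rintro ⟨x, hx, rfl⟩
    exact hx
  · intro hy
    exact ⟨e.symm y, by simpa using hy, by simp⟩

/-- The Cohen–Macaulay clause passes between two models of the local ring at corresponding primes
under a ring isomorphism `e : R ≃+* P`: from `R_{e⁻¹𝔓}` to any `IsLocalization.AtPrime Rₚ 𝔓`.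
[folklore] -/
theorem cmClause_isLocalization_of_ringEquiv {R P : Type u} [CommRing R] [CommRing P]
    (e : R ≃+* P) (𝔓 : Ideal P) [𝔓.IsPrime] (Rₚ : Type u) [CommRing Rₚ] [Algebra P Rₚ]
    [IsLocalization.AtPrime Rₚ 𝔓]
    (h : ∀ d : ℕ, ringKrullDim (Localization.AtPrime (𝔓.comap (e : R →+* P))) = d →
      ∀ s : Fin d → Localization.AtPrime (𝔓.comap (e : R →+* P)),
        (Ideal.span (Set.range s)).radical.IsMaximal →
          RingTheory.Sequence.IsWeaklyRegular (Localization.AtPrime (𝔓.comap (e : R →+* P)))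
            (List.ofFn s)) :
    ∀ d : ℕ, ringKrullDim Rₚ = d → ∀ s : Fin d → Rₚ,
      (Ideal.span (Set.range s)).radical.IsMaximal →
        RingTheory.Sequence.IsWeaklyRegular Rₚ (List.ofFn s) := by
  have e₁ : Localization.AtPrime (𝔓.comap (e : R →+* P)) ≃+* Localization.AtPrime 𝔓 :=
    IsLocalization.ringEquivOfRingEquiv (M := (𝔓.comap (e : R →+* P)).primeCompl)
      (T := 𝔓.primeCompl) (Localization.AtPrime (𝔓.comap (e : R →+* P)))
      (Localization.AtPrime 𝔓) e (map_primeCompl_comap_ringEquiv e 𝔓)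
  have e₂ : Localization.AtPrime 𝔓 ≃+* Rₚ :=
    (IsLocalization.algEquiv 𝔓.primeCompl (Localization.AtPrime 𝔓) Rₚ).toRingEquiv
  exact cmClause_of_ringEquiv (e₁.trans e₂) h

variable (k : Type u) [Field k]

section Model

variable {B : Type u} [CommRing B] [IsDomain B] [Algebra k B] [Algebra.FiniteType k B] {n : ℕ}
  (hB : ringKrullDim B = n) [IsRegularRing B]

include k hB in
/-- `cmClause_localization_of_not_le` for any model `Rₚ` of the local ring `A_𝔓`
(`IsLocalization.AtPrime Rₚ 𝔓`). [cite: Kawasaki2000, La. 2.4 (2)] -/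
theorem cmClause_isLocalization_of_not_le (I : Ideal B) (F : FreeResolution B (B ⧸ I)) {d : ℕ}
    (hd : ringKrullDim (B ⧸ I) = d) (𝔓 : Ideal (B ⧸ I)) [𝔓.IsPrime]
    (hJ : ¬ (∏ q ∈ Finset.Ioc (n - d) (max n 2), Module.annihilator B (F.EMod q)).map
      (Ideal.Quotient.mk I) ≤ 𝔓)
    (Rₚ : Type u) [CommRing Rₚ] [Algebra (B ⧸ I) Rₚ] [IsLocalization.AtPrime Rₚ 𝔓] :
    ∀ d' : ℕ, ringKrullDim Rₚ = d' → ∀ s : Fin d' → Rₚ,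
      (Ideal.span (Set.range s)).radical.IsMaximal →
        RingTheory.Sequence.IsWeaklyRegular Rₚ (List.ofFn s) :=
  cmClause_of_ringEquiv
    (IsLocalization.algEquiv 𝔓.primeCompl (Localization.AtPrime 𝔓) Rₚ).toRingEquiv
    (cmClause_localization_of_not_le k hB I F hd 𝔓 hJ)

include k hB in
/-- **Generic Cohen–Macaulayness along a presentation** `g : B ↠ A` of a domain `A` by a regular
affine `k`-domain `B` of dimension `n`: there is `J ≠ 0` in `A` with `A_𝔓` Cohen–Macaulay for all
primes `𝔓 ⊉ J` (any model `Rₚ` of `A_𝔓`). [cite: Kawasaki2000, La. 2.4 (1),(2)] -/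
theorem exists_ideal_ne_bot_forall_cmClause_of_surjective {A : Type u} [CommRing A] [IsDomain A]
    [Algebra k A] (g : B →ₐ[k] A) (hg : Function.Surjective g) :
    ∃ J : Ideal A, J ≠ ⊥ ∧ ∀ (𝔓 : Ideal A) [𝔓.IsPrime], ¬ J ≤ 𝔓 →
      ∀ (Rₚ : Type u) [CommRing Rₚ] [Algebra A Rₚ] [IsLocalization.AtPrime Rₚ 𝔓],
        ∀ d' : ℕ, ringKrullDim Rₚ = d' → ∀ s : Fin d' → Rₚ,
          (Ideal.span (Set.range s)).radical.IsMaximal →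
            RingTheory.Sequence.IsWeaklyRegular Rₚ (List.ofFn s) := by
  haveI hI : (RingHom.ker g).IsPrime := RingHom.ker_isPrime g
  have e : (B ⧸ RingHom.ker g) ≃+* A := (Ideal.quotientKerAlgEquivOfSurjective hg).toRingEquiv
  haveI : IsDomain (B ⧸ RingHom.ker g) := Ideal.Quotient.isDomain _
  obtain ⟨d, hd, -⟩ :=
    Literature.RingTheory.KrullDimension.exists_ringKrullDim_eq_and_trdeg_eq k (B ⧸ RingHom.ker g)
  haveI : IsNoetherianRing B := Algebra.FiniteType.isNoetherianRing k B
  obtain ⟨F⟩ := (inferInstance : Nonempty (FreeResolution B (B ⧸ RingHom.ker g)))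
  refine ⟨((∏ q ∈ Finset.Ioc (n - d) (max n 2), Module.annihilator B (F.EMod q)).map
    (Ideal.Quotient.mk (RingHom.ker g))).map (e : (B ⧸ RingHom.ker g) →+* A), ?_, ?_⟩
  · -- `J ≠ ⊥`
    intro hJ
    apply map_prod_annihilator_EMod_ne_bot k hB (RingHom.ker g) F hd
    rwa [Ideal.map_eq_bot_iff_of_injective] at hJ
    exact e.injective
  · intro 𝔓 _ hJ𝔓 Rₚ _ _ _
    have hJ' : ¬ (∏ q ∈ Finset.Ioc (n - d) (max n 2), Module.annihilator B (F.EMod q)).map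
        (Ideal.Quotient.mk (RingHom.ker g)) ≤ 𝔓.comap (e : (B ⧸ RingHom.ker g) →+* A) :=
      fun hle => hJ𝔓 (Ideal.map_le_iff_le_comap.mpr hle)
    exact cmClause_isLocalization_of_ringEquiv e 𝔓 Rₚ
      (cmClause_localization_of_not_le k hB (RingHom.ker g) F hd
        (𝔓.comap (e : (B ⧸ RingHom.ker g) →+* A)) hJ')

end Model

/-- **Generic Cohen–Macaulayness of affine domains.** For an integral domain `A` of finite type
over a field `k` there is an ideal `J ≠ 0` of `A` such that for every prime `𝔓 ⊉ J` the local ring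
`A_𝔓` (any model `Rₚ`, e.g. a stalk) is Cohen–Macaulay in the sense that every system of
parameters `s` (`rad (s) = 𝔪`, `|s| = dim`) is a weakly regular sequence: present
`A ≅ k[x₁,…,xₙ]/I` (`k[x₁,…,xₙ]` is a regular domain of dimension `n`) and take the image of the
global `Ext`-annihilator ideal (`ExtAnnihilatorAffineGlobal.lean`).
[cite: Kawasaki2000, La. 2.4 (1),(2); Cesnavicius2021, §2 (AR-b)] -/
theorem exists_ideal_ne_bot_forall_cmClause (A : Type u) [CommRing A] [IsDomain A] [Algebra k A]
    [Algebra.FiniteType k A] :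
    ∃ J : Ideal A, J ≠ ⊥ ∧ ∀ (𝔓 : Ideal A) [𝔓.IsPrime], ¬ J ≤ 𝔓 →
      ∀ (Rₚ : Type u) [CommRing Rₚ] [Algebra A Rₚ] [IsLocalization.AtPrime Rₚ 𝔓],
        ∀ d' : ℕ, ringKrullDim Rₚ = d' → ∀ s : Fin d' → Rₚ,
          (Ideal.span (Set.range s)).radical.IsMaximal →
            RingTheory.Sequence.IsWeaklyRegular Rₚ (List.ofFn s) := by
  obtain ⟨n, f, hf⟩ := Algebra.FiniteType.iff_quotient_mvPolynomial''.mp ‹Algebra.FiniteType k A›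
  exact exists_ideal_ne_bot_forall_cmClause_of_surjective k (ringKrullDim_mvPolynomial_fin_eq k n)
    f hf

end Literature.AlgebraicGeometry.Resolution

end
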